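import Summits.NavierStokesRegularity.NavierStokesRegularity.Theses.TypeILiouville
import Literature.Analysis.FluidPDE.NSQuasipotential
import Literature.Analysis.FluidPDE.BlowupAncientSolutionProofs

/-!
# `TypeIliouvilleNoTypeII` (stmt-NavierStokesRegularity-0056): two junk models for candidate clauses

Negative (support) lemmas for the §B programme «Type-II-exclusion estimates» (D-0081), critic seat
ns-typeII-critic-2 (K-READ rows J0 and M10 of `KILLKIT.md`).  A §B candidate is a clause `D ν T u p`
asserted of every classical solution in the frame of the crux (A-PRIORI form: classical on `[0,T)`,
Leray–Hopf from a rapidly decaying datum) or of every maximal blow-up in it (BLOW-UP form), to be reduced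
to the crux by `Theorems/TypeILiouvilleTypeIliouvilleNoTypeIIDoorCalculus.lean`; or it is a clause on the
bounded ETERNAL mild limit of a Type-II zoom (the export shape of `Theses.DSolutionBubble.TypeIISlowDoublingEternal`,
stmt-NavierStokesRegularity-4064).  This file records, once and schematically, two junk models:

* **J0, the rest state** `u ≡ 0, p ≡ 0`: a classical Leray–Hopf solution from the datum `0` on every
  `[0,T)` which extends smoothly past every `T` (`hasSmoothExtensionPast_zero`, hence never maximal,
  `zero_not_isMaximalSmoothSolution`).  TEMPLATES `aprioriClause_false_of_failsAtRest` (an a-priori-form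
  clause failing at rest is false outright) and `regularClause_false_of_failsAtRest` (so is the REGULAR
  obligation `hreg` of the door calculus for it); INSTANCE `positiveSpeedApriori_false` (every clause
  asserting that the solution is somewhere non-zero — the shape of every concentration / lower-bound
  estimate — is false in a-priori form: such candidates must be filed in blow-up form).
* **M10, constant eternal flows** `w(s,y) = b`, `‖b‖ = 1`: they inhabit the export shape of the Type-II
  zoom package verbatim (`exists_const_typeIIZoomExport`: every time-translate a bounded ancient mild
  solution with `ν = 1` — `Literature.Analysis.FluidPDE.isBoundedAncientMildSolution_fun_const`, KNSS 2009
  §1 p. 3 — jointly smooth, `‖w‖ ≤ 1` for `s ≤ 0`, `‖w‖ ≤ 2`, `‖w 0 0‖ = 1`).  TEMPLATE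
  `zoomClause_not_contradictory_of_const`: a clause `E∞` on the limit which holds on unit constants can
  never turn the export into a contradiction — the Liouville step of a Type-II zoom argument must exclude
  NON-ZERO CONSTANTS (in the Type-I theory the inherited rate does it:
  `Literature.Analysis.FluidPDE.IsTypeIAncientMild.eq_zero_of_slice_const`), so a §B candidate run through
  the zoom must either fail on constants in the limit or come with a non-constancy certificate (tree
  precedent: `Theses.TypeTwoEternal.PaceCell` / `EternalExtraction`, stmt-18162/18163).

WHAT THIS IS NOT: not a statement about Navier–Stokes blow-up; bookkeeping of two degenerate models. [folklore]
-/

noncomputable section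

set_option linter.dupNamespace false

namespace Summit.NavierStokesRegularity.NavierStokesRegularity.Theorems.TypeIliouvilleNoTypeIINegative

open Set Filter Topology Function
open Literature.Analysis.FluidPDE

/-! ## J0 — the rest state -/

/-- The datum of the rest state decays rapidly (all iterated derivatives of the zero field vanish). [folklore] -/
theorem hasRapidSpatialDecay_zero_datum : HasRapidSpatialDecay ((0 : ℝ → (EuclideanSpace ℝ (Fin 3)) → (EuclideanSpace ℝ (Fin 3))) 0) := by
  intro n K
  refine ⟨0, fun x => ?_⟩
  have h0 : ((0 : ℝ → (EuclideanSpace ℝ (Fin 3)) → (EuclideanSpace ℝ (Fin 3))) 0) = fun _ => (0 : (EuclideanSpace ℝ (Fin 3))) := rfl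
  rw [h0, iteratedFDeriv_fun_zero]
  simp

/-- The rest state extends smoothly past every time `T` (by itself, on `[0, T+1)`). [folklore] -/
theorem hasSmoothExtensionPast_zero (ν T : ℝ) : HasSmoothExtensionPast ν 0 (0 : ℝ → (EuclideanSpace ℝ (Fin 3)) → (EuclideanSpace ℝ (Fin 3))) T :=
  ⟨T + 1, lt_add_one T, 0, 0, isClassicalNSSolutionOn_zero _ ν, fun _ _ => rfl⟩

/-- Hence the rest state is never a MAXIMAL smooth solution: blow-up-form clauses do not see it. [folklore] -/
theorem zero_not_isMaximalSmoothSolution (ν T : ℝ) :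
    ¬ IsMaximalSmoothSolution ν 0 (0 : ℝ → (EuclideanSpace ℝ (Fin 3)) → (EuclideanSpace ℝ (Fin 3))) 0 T :=
  fun h => h.2 (hasSmoothExtensionPast_zero ν T)

/-- **TEMPLATE (J0, a-priori form).** An a-priori-form candidate clause over the frame of
`TypeIliouvilleNoTypeII` (classical on `[0,T)`, Leray–Hopf from a rapidly decaying datum, NO maximality)
which fails at the rest state for some `ν, T > 0` is false. [folklore] -/
theorem aprioriClause_false_of_failsAtRest (D : ℝ → ℝ → (ℝ → (EuclideanSpace ℝ (Fin 3)) → (EuclideanSpace ℝ (Fin 3))) → (ℝ → (EuclideanSpace ℝ (Fin 3)) → ℝ) → Prop)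
    {ν T : ℝ} (hν : 0 < ν) (hT : 0 < T) (hD : ¬ D ν T 0 0) :
    ¬ (∀ (ν T : ℝ), 0 < ν → 0 < T → ∀ (u : ℝ → (EuclideanSpace ℝ (Fin 3)) → (EuclideanSpace ℝ (Fin 3))) (p : ℝ → (EuclideanSpace ℝ (Fin 3)) → ℝ),
        IsClassicalNSSolutionOn (Set.Ico 0 T) ν 0 u p → IsLerayHopfOn T ν 0 (u 0) u →
        HasRapidSpatialDecay (u 0) → D ν T u p) := fun h =>
  hD (h ν T hν hT 0 0 (isClassicalNSSolutionOn_zero _ ν) (isLerayHopfOn_zero T ν)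
    hasRapidSpatialDecay_zero_datum)

/-- **TEMPLATE (J0, regular obligation).** The REGULAR obligation of the door calculus («`D` holds on
every solution of the frame which extends smoothly past `T`», hypothesis `hreg` of
`aprioriClause_iff_typeIliouvilleNoTypeII`) fails for every clause failing at the rest state. [folklore] -/
theorem regularClause_false_of_failsAtRest (D : ℝ → ℝ → (ℝ → (EuclideanSpace ℝ (Fin 3)) → (EuclideanSpace ℝ (Fin 3))) → (ℝ → (EuclideanSpace ℝ (Fin 3)) → ℝ) → Prop)
    {ν T : ℝ} (hν : 0 < ν) (hT : 0 < T) (hD : ¬ D ν T 0 0) :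
    ¬ (∀ (ν T : ℝ), 0 < ν → 0 < T → ∀ (u : ℝ → (EuclideanSpace ℝ (Fin 3)) → (EuclideanSpace ℝ (Fin 3))) (p : ℝ → (EuclideanSpace ℝ (Fin 3)) → ℝ),
        IsClassicalNSSolutionOn (Set.Ico 0 T) ν 0 u p → IsLerayHopfOn T ν 0 (u 0) u →
        HasRapidSpatialDecay (u 0) → HasSmoothExtensionPast ν 0 u T → D ν T u p) := fun h =>
  hD (h ν T hν hT 0 0 (isClassicalNSSolutionOn_zero _ ν) (isLerayHopfOn_zero T ν)
    hasRapidSpatialDecay_zero_datum (hasSmoothExtensionPast_zero ν T))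

/-- **INSTANCE (J0).** «Every classical Leray–Hopf solution from a rapidly decaying datum is non-zero
somewhere at some time» is false (rest state): concentration / lower-bound clauses cannot be filed in
a-priori form. [folklore] -/
theorem positiveSpeedApriori_false :
    ¬ (∀ (ν T : ℝ), 0 < ν → 0 < T → ∀ (u : ℝ → (EuclideanSpace ℝ (Fin 3)) → (EuclideanSpace ℝ (Fin 3))) (p : ℝ → (EuclideanSpace ℝ (Fin 3)) → ℝ),
        IsClassicalNSSolutionOn (Set.Ico 0 T) ν 0 u p → IsLerayHopfOn T ν 0 (u 0) u →
        HasRapidSpatialDecay (u 0) → ∃ t x, 0 < ‖u t x‖) :=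
  aprioriClause_false_of_failsAtRest (fun _ _ u _ => ∃ t x, 0 < ‖u t x‖) one_pos one_pos (by simp)

/-! ## M10 — constant eternal flows inhabit the Type-II zoom export -/

/-- **M10.** The export shape of the Type-II zoom package (verbatim the `∃ w, …` body of
`Theses.DSolutionBubble.TypeIISlowDoublingEternal`, stmt-NavierStokesRegularity-4064) is inhabited by a
spatially and temporally CONSTANT field `w ≡ b`, `‖b‖ = 1` (KNSS 2009, §1 p. 3: constants are bounded
ancient mild solutions). [cite: KochNadirashviliSereginSverak2009, §1 p. 3] -/
theorem exists_const_typeIIZoomExport :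
    ∃ w : ℝ → (EuclideanSpace ℝ (Fin 3)) → (EuclideanSpace ℝ (Fin 3)),
      ((∀ s₀ : ℝ, IsBoundedAncientMildSolution 1 (fun s y => w (s + s₀) y)) ∧
        ContDiff ℝ (⊤ : ℕ∞) (Function.uncurry w) ∧ (∀ s ≤ (0 : ℝ), ∀ y, ‖w s y‖ ≤ 1) ∧
        (∀ s y, ‖w s y‖ ≤ 2) ∧ ‖w 0 0‖ = 1) ∧
      ∀ s y, w s y = w 0 0 := by
  set b : (EuclideanSpace ℝ (Fin 3)) := EuclideanSpace.single 0 (1 : ℝ) with hb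
  have hnb : ‖b‖ = 1 := by simp [hb]
  refine ⟨fun _ _ => b, ⟨fun s₀ => ?_, ?_, fun s _ y => hnb.le, fun s y => ?_, hnb⟩, fun _ _ => rfl⟩
  · exact isBoundedAncientMildSolution_fun_const 1 b
  · exact contDiff_const
  · rw [hnb]; norm_num

/-- **TEMPLATE (M10).** A clause `E∞` on the zoom limit which holds on every unit constant field can never
turn the Type-II zoom export into a contradiction: the Liouville step must exclude NON-ZERO CONSTANTS by
some inherited information (in the Type-I theory, the rate: `IsTypeIAncientMild.eq_zero_of_slice_const`).
[folklore] -/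
theorem zoomClause_not_contradictory_of_const (Einf : (ℝ → (EuclideanSpace ℝ (Fin 3)) → (EuclideanSpace ℝ (Fin 3))) → Prop)
    (hconst : ∀ b : (EuclideanSpace ℝ (Fin 3)), ‖b‖ = 1 → Einf (fun _ _ => b)) :
    ¬ (∀ w : ℝ → (EuclideanSpace ℝ (Fin 3)) → (EuclideanSpace ℝ (Fin 3)),
        (∀ s₀ : ℝ, IsBoundedAncientMildSolution 1 (fun s y => w (s + s₀) y)) →
        ContDiff ℝ (⊤ : ℕ∞) (Function.uncurry w) → (∀ s ≤ (0 : ℝ), ∀ y, ‖w s y‖ ≤ 1) →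
        (∀ s y, ‖w s y‖ ≤ 2) → ‖w 0 0‖ = 1 → Einf w → False) := by
  intro h
  obtain ⟨w, ⟨h1, h2, h3, h4, h5⟩, hc⟩ := exists_const_typeIIZoomExport
  have hw : w = fun _ _ => w 0 0 := funext fun s => funext fun y => hc s y
  exact h w h1 h2 h3 h4 h5 (hw ▸ hconst (w 0 0) h5)

/-- **INSTANCE (M10).** In particular the bare export is consistent (no contradiction without a further
clause), and «the limit vanishes identically» is not a consequence of it. [folklore] -/
theorem typeIIZoomExport_not_forces_zero :
    ¬ (∀ w : ℝ → (EuclideanSpace ℝ (Fin 3)) → (EuclideanSpace ℝ (Fin 3)),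
        (∀ s₀ : ℝ, IsBoundedAncientMildSolution 1 (fun s y => w (s + s₀) y)) →
        ContDiff ℝ (⊤ : ℕ∞) (Function.uncurry w) → (∀ s ≤ (0 : ℝ), ∀ y, ‖w s y‖ ≤ 1) →
        (∀ s y, ‖w s y‖ ≤ 2) → ‖w 0 0‖ = 1 → ∀ s y, w s y = 0) := by
  intro h
  obtain ⟨w, ⟨h1, h2, h3, h4, h5⟩, -⟩ := exists_const_typeIIZoomExport
  have := h w h1 h2 h3 h4 h5 0 0
  rw [this, norm_zero] at h5
  exact zero_ne_one h5

end Summit.NavierStokesRegularity.NavierStokesRegularity.Theorems.TypeIliouvilleNoTypeIINegative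

end
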